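import Summits.HubbardSuperconductivity.HubbardSuperconductivity.Theorems.ThermalWedgeTwSeededEnsembleEquivalenceRSubgradientSelection

/-!
# Crux `TwSeededEnsembleEquivalenceR` (stmt-HubbardSuperconductivity-15581), line `cold-floor-collapse`
# (slug `Sketch`, skeleton v8) — NoSplit FROM (NON-STRICT) CONCAVITY IN THE SQUARED SOURCE: the quantified glues

Support file (`--supports stmt-HubbardSuperconductivity-15581`; sorry-free; no definition; route-file free).

With the minimax selection of `…RSubgradientSelection` (`nsc_noSplitAt_of_concaveOn`), the physics input NoSplit of
`stub_twoPhaseClosure` (skeleton v8, `Cruxes/TwSeededEnsembleEquivalenceR/Lines/Sketch.lean`) is obtained from plain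
concavity of the cold sourced limit pressure in `s = h²` — in two shapes:

* `nsc_noSplit_of_floor_of_deepConcavity` — **FLOOR + DEEP-CONC ⟹ NoSplit**: FLOOR is the type of the landed
  `stub_optimiserFloor hC` verbatim; DEEP-CONC is the quantifier shape of DEEP-SCONC
  (`usc_stub_sourcedColdUniqDeep_of_deepStrictConcavity`, p125881) with `StrictConcaveOn` weakened to
  `ConcaveOn ℝ [e^{−a/(2U)}, (13g+1)²] (s ↦ q μ √s)`; NoSplit is the conclusion of the registered `stub_noSplitGlue` /
  the fifth hypothesis of `stub_twoPhaseClosure` verbatim. Hence in `TwSeededEnsembleEquivalenceR_of` the term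
  `stub_noSplitGlue (stub_optimiserFloor hC) stub_sourcedColdUniqDeep` can be replaced by
  `nsc_noSplit_of_floor_of_deepConcavity (stub_optimiserFloor hC) ‹DEEP-CONC›`: the line's physics stub drops from
  "unique optimal modulus / strict concavity with an `L`-uniform modulus" to concavity, which passes to the limit
  from finite volume with no modulus — `nsc_deepConcavity_of_finiteVolume` (FV-DEEP-CONC ⟹ DEEP-CONC).
* `nsc_noSplit_of_concavity` — **CONC ⟹ NoSplit with NO floor and NO condensation input**: concavity of
  `s ↦ q(μ,√s)` on the whole squared box `[0,(13g+1)²]` (true and elementary at `U = 0` for every `β`: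
  `E ↦ tanh(βE/2)/E` decreases) gives NoSplit directly, so `stub_twoPhaseClosure S1 S2 S4 S5 (nsc_noSplit_of_concavity
  CONC)` closes the cold slice WITHOUT `TwSourcedCondensation` (stmt-1697); `nsc_concavity_of_finiteVolume`
  (FV-CONC ⟹ CONC).

Gibbs-state reading of FV-(DEEP-)CONC (cf. `ups_hasDerivAt_sourcedPressure_sq`, …RUniqOfPairingSaturation): the chord
pair susceptibility `Re⟨Δ_d+Δ_d†⟩_{β,L,U,μ,√s}/(2√s·L²)` is NON-INCREASING in the squared source on the range in
question, eventually in `L` — no metamagnetic upturn of the pair response; equivalently the differential pair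
susceptibility never exceeds the chord one. This is what a convergent sourced expansion two source-derivatives deep
delivers (relative corrections `O(U) + O(a)` to the free BdG law), and nothing sharper is needed by the line.
[folklore composition]
-/

set_option linter.dupNamespace false

namespace Summit.HubbardSuperconductivity.HubbardSuperconductivity.Theorems

open Set Filter Topology Matrix Literature.MathematicalPhysics.QuantumLattice
open Summit.AnomalousDissipation.AnomalousDissipation.Theorems.TaylorCertificatesFloorCertificate
open Summit.HubbardSuperconductivity.HubbardSuperconductivity.Theorems.TwSourcedCondensation.Negative
open Summit.HubbardSuperconductivity.HubbardSuperconductivity.Theorems.TwSeededEnsembleEquivalenceR.ColdFloorLine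
open scoped ComplexOrder

noncomputable section

/-! ### The quantified glues for skeleton v8 -/

/-- **CONC ⟹ NoSplit (no floor, no condensation input).** If on every compact window `⊂ (−4,0)` there are
`a, K', U₀ > 0` such that every pointwise thermodynamic limit `q` of the sourced torus pressure at `β = e^{a/U}` on
`[μ₁,μ₂] × [−(13g+1), 13g+1]` (`0 < U ≤ U₀`, `K'U ≤ g ≤ 1/10`) has `s ↦ q μ √s` CONCAVE on the whole squared box
`[0, (13g+1)²]` for interior `μ`, then NoSplit holds — the conclusion of `stub_noSplitGlue` / fifth hypothesis of
`stub_twoPhaseClosure` of skeleton v8, verbatim. No optimiser floor and no `TwSourcedCondensation` are used.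
[folklore composition] -/
theorem nsc_noSplit_of_concavity :
    (∀ (μ₁ μ₂ : ℝ), -4 < μ₁ → μ₁ < μ₂ → μ₂ < 0 → ∃ a K' U₀ : ℝ, 0 < a ∧ 0 < K' ∧ 0 < U₀ ∧
      ∀ U ∈ Set.Ioc (0 : ℝ) U₀, ∀ g ∈ Set.Icc (K' * U) (1 / 10), ∀ q : ℝ → ℝ → ℝ,
        (∀ μ ∈ Set.Icc μ₁ μ₂, ∀ h ∈ Set.Icc (-(13 * g + 1)) (13 * g + 1), ∀ κ : ℝ, 0 < κ →
            ∃ L₀ : ℕ, ∀ (L : ℕ) [NeZero L], L₀ ≤ L →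
              |Real.log (Matrix.partitionFn (Real.exp (a / U)) (dWaveSourceTorus L U μ h)).re /
                  (Real.exp (a / U) * (L : ℝ) ^ 2) - q μ h| ≤ κ) →
        ∀ μ ∈ Set.Ioo μ₁ μ₂,
          ConcaveOn ℝ (Set.Icc 0 ((13 * g + 1) ^ 2)) (fun s : ℝ => q μ (Real.sqrt s))) →
    ∀ (μ₁ μ₂ : ℝ), -4 < μ₁ → μ₁ < μ₂ → μ₂ < 0 → ∃ a K' U₀ : ℝ, 0 < a ∧ 0 < K' ∧ 0 < U₀ ∧
      ∀ U ∈ Set.Ioc (0 : ℝ) U₀, ∀ g ∈ Set.Icc (K' * U) (1 / 10), ∀ q : ℝ → ℝ → ℝ,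
        (∀ μ ∈ Set.Icc μ₁ μ₂, ∀ h ∈ Set.Icc (-(13 * g + 1)) (13 * g + 1), ∀ κ : ℝ, 0 < κ →
            ∃ L₀ : ℕ, ∀ (L : ℕ) [NeZero L], L₀ ≤ L →
              |Real.log (Matrix.partitionFn (Real.exp (a / U)) (dWaveSourceTorus L U μ h)).re /
                  (Real.exp (a / U) * (L : ℝ) ^ 2) - q μ h| ≤ κ) →
        ∀ μ ∈ Set.Ioo μ₁ μ₂, ∀ ν : ℝ,
          (∀ μ' ∈ Set.Icc μ₁ μ₂, sSup ((fun h' : ℝ => q μ h' - h' ^ 2 / g) '' Set.Icc (-(13 * g + 1)) (13 * g + 1)) + ν * (μ' - μ) ≤ sSup ((fun h' : ℝ => q μ' h' - h' ^ 2 / g) '' Set.Icc (-(13 * g + 1)) (13 * g + 1))) →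
          ∃ h₀ ∈ Set.Icc (-(13 * g + 1)) (13 * g + 1),
            q μ h₀ - h₀ ^ 2 / g = sSup ((fun h' : ℝ => q μ h' - h' ^ 2 / g) '' Set.Icc (-(13 * g + 1)) (13 * g + 1)) ∧
            ∀ μ' ∈ Set.Icc μ₁ μ₂, q μ h₀ + ν * (μ' - μ) ≤ q μ' h₀ := by
  intro hC μ₁ μ₂ h4 h12 h0
  obtain ⟨a, K', U₀, ha, hK', hU₀, hA⟩ := hC μ₁ μ₂ h4 h12 h0
  refine ⟨a, K', U₀, ha, hK', hU₀, fun U hU g hg q hq μ hμ ν hν => ?_⟩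
  have hg0 : 0 < g := lt_of_lt_of_le (mul_pos hK' hU.1) hg.1
  have hR : 0 < 13 * g + 1 := by positivity
  exact nsc_noSplitAt_of_concaveOn U _ g _ μ₁ μ₂ 0 (Real.exp_pos _) hg0 hR le_rfl (by positivity) q hq
    (fun μ' _ h _ _ => sq_nonneg h) (hA U hU g hg q hq) μ hμ ν hν

/-- **FLOOR + DEEP-CONC ⟹ NoSplit.** First hypothesis: FLOOR, the type of the landed `stub_optimiserFloor hC`
(every maximiser of the cold payoff is a deep source, `e^{−a/(4U)} ≤ |h|`, for all small exponents `a ≤ a₂`).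
Second hypothesis: DEEP-CONC, the quantifier shape of DEEP-SCONC (`usc_stub_sourcedColdUniqDeep_of_deepStrictConcavity`)
with strict concavity weakened to `ConcaveOn ℝ [e^{−a/(2U)}, (13g+1)²] (s ↦ q μ √s)`. Conclusion: NoSplit verbatim
(with `a := min a₁ a₂`, `K' := max`, `U₀ := min`). So in `TwSeededEnsembleEquivalenceR_of` the pair
`stub_noSplitGlue (stub_optimiserFloor hC) stub_sourcedColdUniqDeep` may be replaced by
`nsc_noSplit_of_floor_of_deepConcavity (stub_optimiserFloor hC) ‹DEEP-CONC›`. [folklore composition] -/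
theorem nsc_noSplit_of_floor_of_deepConcavity :
    (∀ (μ₁ μ₂ : ℝ), -4 < μ₁ → μ₁ < μ₂ → μ₂ < 0 → ∃ a₂ : ℝ, 0 < a₂ ∧ ∀ a ∈ Set.Ioc (0 : ℝ) a₂,
      ∃ K' U₀ : ℝ, 0 < K' ∧ 0 < U₀ ∧ ∀ U ∈ Set.Ioc (0 : ℝ) U₀, ∀ g ∈ Set.Icc (K' * U) (1 / 10),
        ∀ q : ℝ → ℝ → ℝ,
          (∀ μ ∈ Set.Icc μ₁ μ₂, ∀ h ∈ Set.Icc (-(13 * g + 1)) (13 * g + 1), ∀ κ : ℝ, 0 < κ →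
            ∃ L₀ : ℕ, ∀ (L : ℕ) [NeZero L], L₀ ≤ L →
              |Real.log (Matrix.partitionFn (Real.exp (a / U)) (dWaveSourceTorus L U μ h)).re /
                  (Real.exp (a / U) * (L : ℝ) ^ 2) - q μ h| ≤ κ) →
          ∀ μ ∈ Set.Icc μ₁ μ₂, ∀ h ∈ Set.Icc (-(13 * g + 1)) (13 * g + 1),
            q μ h - h ^ 2 / g = sSup ((fun h' : ℝ => q μ h' - h' ^ 2 / g) '' Set.Icc (-(13 * g + 1)) (13 * g + 1)) →
              Real.exp (-(a / (4 * U))) ≤ |h|) →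
    (∀ (μ₁ μ₂ : ℝ), -4 < μ₁ → μ₁ < μ₂ → μ₂ < 0 → ∃ a₁ : ℝ, 0 < a₁ ∧ ∀ a ∈ Set.Ioc (0 : ℝ) a₁,
      ∃ K' U₀ : ℝ, 0 < K' ∧ 0 < U₀ ∧ ∀ U ∈ Set.Ioc (0 : ℝ) U₀, ∀ g ∈ Set.Icc (K' * U) (1 / 10),
        ∀ q : ℝ → ℝ → ℝ,
          (∀ μ ∈ Set.Icc μ₁ μ₂, ∀ h ∈ Set.Icc (-(13 * g + 1)) (13 * g + 1), ∀ κ : ℝ, 0 < κ →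
            ∃ L₀ : ℕ, ∀ (L : ℕ) [NeZero L], L₀ ≤ L →
              |Real.log (Matrix.partitionFn (Real.exp (a / U)) (dWaveSourceTorus L U μ h)).re /
                  (Real.exp (a / U) * (L : ℝ) ^ 2) - q μ h| ≤ κ) →
          ∀ μ ∈ Set.Ioo μ₁ μ₂,
            ConcaveOn ℝ (Set.Icc (Real.exp (-(a / (2 * U)))) ((13 * g + 1) ^ 2))
              (fun s : ℝ => q μ (Real.sqrt s))) →
    ∀ (μ₁ μ₂ : ℝ), -4 < μ₁ → μ₁ < μ₂ → μ₂ < 0 → ∃ a K' U₀ : ℝ, 0 < a ∧ 0 < K' ∧ 0 < U₀ ∧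
      ∀ U ∈ Set.Ioc (0 : ℝ) U₀, ∀ g ∈ Set.Icc (K' * U) (1 / 10), ∀ q : ℝ → ℝ → ℝ,
        (∀ μ ∈ Set.Icc μ₁ μ₂, ∀ h ∈ Set.Icc (-(13 * g + 1)) (13 * g + 1), ∀ κ : ℝ, 0 < κ →
            ∃ L₀ : ℕ, ∀ (L : ℕ) [NeZero L], L₀ ≤ L →
              |Real.log (Matrix.partitionFn (Real.exp (a / U)) (dWaveSourceTorus L U μ h)).re /
                  (Real.exp (a / U) * (L : ℝ) ^ 2) - q μ h| ≤ κ) →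
        ∀ μ ∈ Set.Ioo μ₁ μ₂, ∀ ν : ℝ,
          (∀ μ' ∈ Set.Icc μ₁ μ₂, sSup ((fun h' : ℝ => q μ h' - h' ^ 2 / g) '' Set.Icc (-(13 * g + 1)) (13 * g + 1)) + ν * (μ' - μ) ≤ sSup ((fun h' : ℝ => q μ' h' - h' ^ 2 / g) '' Set.Icc (-(13 * g + 1)) (13 * g + 1))) →
          ∃ h₀ ∈ Set.Icc (-(13 * g + 1)) (13 * g + 1),
            q μ h₀ - h₀ ^ 2 / g = sSup ((fun h' : ℝ => q μ h' - h' ^ 2 / g) '' Set.Icc (-(13 * g + 1)) (13 * g + 1)) ∧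
            ∀ μ' ∈ Set.Icc μ₁ μ₂, q μ h₀ + ν * (μ' - μ) ≤ q μ' h₀ := by
  intro hF hC μ₁ μ₂ h4 h12 h0
  obtain ⟨a₂, ha₂, hA₂⟩ := hF μ₁ μ₂ h4 h12 h0
  obtain ⟨a₁, ha₁, hA₁⟩ := hC μ₁ μ₂ h4 h12 h0
  set a : ℝ := min a₁ a₂ with ha_def
  have ha0 : 0 < a := lt_min ha₁ ha₂
  obtain ⟨KF, UF, hKF, hUF, hBF⟩ := hA₂ a ⟨ha0, min_le_right _ _⟩
  obtain ⟨KC, UC, hKC, hUC, hBC⟩ := hA₁ a ⟨ha0, min_le_left _ _⟩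
  refine ⟨a, max KF KC, min UF UC, ha0, lt_max_of_lt_left hKF, lt_min hUF hUC,
    fun U hU g hg q hq μ hμ ν hν => ?_⟩
  have hUF' : U ∈ Set.Ioc (0 : ℝ) UF := ⟨hU.1, hU.2.trans (min_le_left _ _)⟩
  have hUC' : U ∈ Set.Ioc (0 : ℝ) UC := ⟨hU.1, hU.2.trans (min_le_right _ _)⟩
  have hgF : g ∈ Set.Icc (KF * U) (1 / 10) :=
    ⟨(mul_le_mul_of_nonneg_right (le_max_left KF KC) hU.1.le).trans hg.1, hg.2⟩
  have hgC : g ∈ Set.Icc (KC * U) (1 / 10) :=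
    ⟨(mul_le_mul_of_nonneg_right (le_max_right KF KC) hU.1.le).trans hg.1, hg.2⟩
  have hg0 : 0 < g := lt_of_lt_of_le (mul_pos hKC hU.1) hgC.1
  have hR : 0 < 13 * g + 1 := by positivity
  have floor := hBF U hUF' g hgF q hq
  have conc := hBC U hUC' g hgC q hq
  have hsfR : Real.exp (-(a / (2 * U))) ≤ (13 * g + 1) ^ 2 := by
    have h1 : Real.exp (-(a / (2 * U))) ≤ 1 := by
      rw [Real.exp_le_one_iff, neg_nonpos]
      exact div_nonneg ha0.le (by linarith [hU.1])
    nlinarith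
  exact nsc_noSplitAt_of_concaveOn U _ g _ μ₁ μ₂ _ (Real.exp_pos _) hg0 hR (Real.exp_pos _).le hsfR q hq
    (fun μ' hμ' h hh hmax => (uscd_sq_mem_Icc_of_deep hh (floor μ' hμ' h hh hmax)).1) conc μ hμ ν hν

/-- **FV-CONC ⟹ CONC** (whole squared box `[0,(13g+1)²]`, shape of the hypothesis of `nsc_noSplit_of_concavity`):
if for interior `μ` the finite-volume cold sourced pressure `s ↦ p̃_L(e^{a/U}; U, μ, √s)` is concave on `[0,(13g+1)²]`
for all large `L`, then so is every pointwise limit `q`. [folklore] -/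
theorem nsc_concavity_of_finiteVolume :
    (∀ (μ₁ μ₂ : ℝ), -4 < μ₁ → μ₁ < μ₂ → μ₂ < 0 → ∃ a K' U₀ : ℝ, 0 < a ∧ 0 < K' ∧ 0 < U₀ ∧
      ∀ U ∈ Set.Ioc (0 : ℝ) U₀, ∀ g ∈ Set.Icc (K' * U) (1 / 10), ∀ μ ∈ Set.Ioo μ₁ μ₂,
        ∃ L₀ : ℕ, ∀ (L : ℕ) [NeZero L], L₀ ≤ L →
          ConcaveOn ℝ (Set.Icc 0 ((13 * g + 1) ^ 2)) (fun s : ℝ =>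
            Real.log (Matrix.partitionFn (Real.exp (a / U)) (dWaveSourceTorus L U μ (Real.sqrt s))).re /
              (Real.exp (a / U) * (L : ℝ) ^ 2))) →
    (∀ (μ₁ μ₂ : ℝ), -4 < μ₁ → μ₁ < μ₂ → μ₂ < 0 → ∃ a K' U₀ : ℝ, 0 < a ∧ 0 < K' ∧ 0 < U₀ ∧
      ∀ U ∈ Set.Ioc (0 : ℝ) U₀, ∀ g ∈ Set.Icc (K' * U) (1 / 10), ∀ q : ℝ → ℝ → ℝ,
        (∀ μ ∈ Set.Icc μ₁ μ₂, ∀ h ∈ Set.Icc (-(13 * g + 1)) (13 * g + 1), ∀ κ : ℝ, 0 < κ →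
            ∃ L₀ : ℕ, ∀ (L : ℕ) [NeZero L], L₀ ≤ L →
              |Real.log (Matrix.partitionFn (Real.exp (a / U)) (dWaveSourceTorus L U μ h)).re /
                  (Real.exp (a / U) * (L : ℝ) ^ 2) - q μ h| ≤ κ) →
        ∀ μ ∈ Set.Ioo μ₁ μ₂,
          ConcaveOn ℝ (Set.Icc 0 ((13 * g + 1) ^ 2)) (fun s : ℝ => q μ (Real.sqrt s))) := by
  intro hFV μ₁ μ₂ h4 h12 h0
  obtain ⟨a, K', U₀, ha, hK', hU₀, hA⟩ := hFV μ₁ μ₂ h4 h12 h0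
  refine ⟨a, K', U₀, ha, hK', hU₀, fun U hU g hg q hq μ hμ => ?_⟩
  have hg0 : 0 < g := lt_of_lt_of_le (mul_pos hK' hU.1) hg.1
  exact nsc_concaveOn_sqrt_of_finiteVolume (by positivity) ⟨hμ.1.le, hμ.2.le⟩ hq (hA U hU g hg μ hμ)

/-- **FV-DEEP-CONC ⟹ DEEP-CONC** (regulated range `[e^{−a/(2U)}, (13g+1)²]`, shape of the second hypothesis of
`nsc_noSplit_of_floor_of_deepConcavity`): eventual finite-volume concavity of `s ↦ p̃_L(e^{a/U}; U, μ, √s)` on the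
regulated range gives the same for every pointwise limit `q`. [folklore] -/
theorem nsc_deepConcavity_of_finiteVolume :
    (∀ (μ₁ μ₂ : ℝ), -4 < μ₁ → μ₁ < μ₂ → μ₂ < 0 → ∃ a₁ : ℝ, 0 < a₁ ∧ ∀ a ∈ Set.Ioc (0 : ℝ) a₁,
      ∃ K' U₀ : ℝ, 0 < K' ∧ 0 < U₀ ∧ ∀ U ∈ Set.Ioc (0 : ℝ) U₀, ∀ g ∈ Set.Icc (K' * U) (1 / 10),
        ∀ μ ∈ Set.Ioo μ₁ μ₂, ∃ L₀ : ℕ, ∀ (L : ℕ) [NeZero L], L₀ ≤ L →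
          ConcaveOn ℝ (Set.Icc (Real.exp (-(a / (2 * U)))) ((13 * g + 1) ^ 2)) (fun s : ℝ =>
            Real.log (Matrix.partitionFn (Real.exp (a / U)) (dWaveSourceTorus L U μ (Real.sqrt s))).re /
              (Real.exp (a / U) * (L : ℝ) ^ 2))) →
    (∀ (μ₁ μ₂ : ℝ), -4 < μ₁ → μ₁ < μ₂ → μ₂ < 0 → ∃ a₁ : ℝ, 0 < a₁ ∧ ∀ a ∈ Set.Ioc (0 : ℝ) a₁,
      ∃ K' U₀ : ℝ, 0 < K' ∧ 0 < U₀ ∧ ∀ U ∈ Set.Ioc (0 : ℝ) U₀, ∀ g ∈ Set.Icc (K' * U) (1 / 10),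
        ∀ q : ℝ → ℝ → ℝ,
          (∀ μ ∈ Set.Icc μ₁ μ₂, ∀ h ∈ Set.Icc (-(13 * g + 1)) (13 * g + 1), ∀ κ : ℝ, 0 < κ →
            ∃ L₀ : ℕ, ∀ (L : ℕ) [NeZero L], L₀ ≤ L →
              |Real.log (Matrix.partitionFn (Real.exp (a / U)) (dWaveSourceTorus L U μ h)).re /
                  (Real.exp (a / U) * (L : ℝ) ^ 2) - q μ h| ≤ κ) →
          ∀ μ ∈ Set.Ioo μ₁ μ₂,
            ConcaveOn ℝ (Set.Icc (Real.exp (-(a / (2 * U)))) ((13 * g + 1) ^ 2))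
              (fun s : ℝ => q μ (Real.sqrt s))) := by
  intro hFV μ₁ μ₂ h4 h12 h0
  obtain ⟨a₁, ha₁, hA⟩ := hFV μ₁ μ₂ h4 h12 h0
  refine ⟨a₁, ha₁, fun a ha => ?_⟩
  obtain ⟨K', U₀, hK', hU₀, hB⟩ := hA a ha
  refine ⟨K', U₀, hK', hU₀, fun U hU g hg q hq μ hμ => ?_⟩
  have hg0 : 0 < g := lt_of_lt_of_le (mul_pos hK' hU.1) hg.1
  exact nsc_concaveOn_sqrt_of_finiteVolume (by positivity) ⟨hμ.1.le, hμ.2.le⟩ hq (hB U hU g hg μ hμ)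

end

end Summit.HubbardSuperconductivity.HubbardSuperconductivity.Theorems
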